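import Mathlib
import Summits.ValiantsHypothesis.ValiantsHypothesis.Theorems.NewtonUnitEquationsDissociatedUniformTotalsLaw
import Summits.ValiantsHypothesis.ValiantsHypothesis.Theorems.NewtonUnitEquationsDissociatedUniformTotalsLawHeavyPairs
import Summits.ValiantsHypothesis.ValiantsHypothesis.Theorems.NewtonUnitEquationsDissociatedUniformTotalsLawTriangleWords
import Summits.ValiantsHypothesis.ValiantsHypothesis.Theorems.NewtonUnitEquationsDissociatedUniformTotalsLawChartSamples
import Literature.Computability.AlgebraicComplexity.NewtonPolygonTauProductBounds
import HarnessLib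

/-!
# Crux `NewtonUnitEquations.DissociatedUniform` (stmt-ValiantsHypothesis-5905), `n = 3` totals law of model (Q**):
# CHART TRIANGLES — class chart tops are triangle words of the sampled pair-top systems

Companion of `…TotalsLawChartSamples` (tie-broken top letters `topLetter`, generic sample times `tau`, the interval systems
`TPs/TQs/TRs`) and `…TotalsLawTriangleWords` (`IsTri`, `triWords`).  Here: `sum_card_chartTops_le_card_triWords` —
`∑_s #tops_σ(class s) ≤ #triWords`: a chart top `v` of class `s` along the half-chart `σ`, read through its LEAST SPELLING
`(x, y, z)` (least code of `x`, then of `y`), is a triangle word at its sample time — a class top is a top of each pair fibre through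
it (`isStrictTop_of_add_left`), and the least spelling is exactly what the tie-break of `topLetter` selects — injectively in `v`.
The assembly `T(a,b,c) = O(|G|^{5/2})` is `…TotalsLawSubCubic`.  Nothing here bears on VP ≠ VNP.
[folklore]
-/

set_option linter.dupNamespace false -- `ValiantsHypothesis.ValiantsHypothesis` (summit = problem) in every name

open Finset Matrix

namespace Summit.ValiantsHypothesis.ValiantsHypothesis.Theorems.NewtonUnitEquationsDissociatedUniform

namespace TotalsLaw

open Literature.Computability.AlgebraicComplexity.KPTT.PlanarMinkowski

variable {G : Type*} [AddCommGroup G] [Fintype G] [DecidableEq G]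

section Geometry

variable {a b c : G → (Fin 2 → ℝ)} {σ : ℝ}


omit [AddCommGroup G] [Fintype G] [DecidableEq G] in
/-- A strict top `u + p` of `F`, all of whose fibre competitors `u + y` (`y ∈ Fib`) lie in `F`, has `p` a strict top of `Fib`.
[folklore] -/
theorem isStrictTop_of_add_left {w u p : Fin 2 → ℝ} {F Fib : Finset (Fin 2 → ℝ)} (h : IsStrictTop w F (u + p))
    (hp : p ∈ Fib) (hF : ∀ y ∈ Fib, u + y ∈ F) : IsStrictTop w Fib p := by
  refine ⟨hp, fun y hy hne => ?_⟩
  have hne' : u + y ≠ u + p := fun e => hne (add_left_cancel e)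
  have := h.lt (hF y hy) hne'
  rw [dotProduct_add, dotProduct_add] at this
  linarith

variable (a b c σ) in
open Classical in
/-- **Chart tops of a class inject into the triangle words of that class.** [folklore] -/
theorem card_chartTops_le_card_triWords_fiber (s : G) :
    ((univ.image fun p : G × G => a p.1 + b p.2 + c (s - p.1 - p.2)).filter fun v =>
        ∃ t, IsStrictTop ![σ, t] (univ.image fun p : G × G => a p.1 + b p.2 + c (s - p.1 - p.2)) v).card ≤
      ((triWords (Nσ a b c σ) (TPs a b c σ) (TQs a b c σ) (TRs a b c σ)).filter
        fun w => w.1 + w.2.1 + w.2.2 = s).card := by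
  classical
  set F := univ.image fun p : G × G => a p.1 + b p.2 + c (s - p.1 - p.2) with hF
  have hmemF : ∀ {x y z : G}, x + y + z = s → a x + b y + c z ∈ F := fun {x y z} h =>
    mem_image.2 ⟨(x, y), mem_univ _, by rw [show s - x - y = z by rw [← h]; abel]⟩
  -- least first letter
  have hX : ∀ v ∈ F, ∃ x : G, (∃ y, a x + b y + c (s - x - y) = v) ∧
      ∀ x', (∃ y, a x' + b y + c (s - x' - y) = v) → enc x ≤ enc x' := by
    intro v hv
    obtain ⟨⟨x₀, y₀⟩, -, h₀⟩ := mem_image.1 hv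
    obtain ⟨x, hx, hmin⟩ := exists_min_image (univ.filter fun x : G => ∃ y, a x + b y + c (s - x - y) = v) enc
      ⟨x₀, mem_filter.2 ⟨mem_univ _, y₀, h₀⟩⟩
    exact ⟨x, (mem_filter.1 hx).2, fun x' hx' => hmin x' (mem_filter.2 ⟨mem_univ _, hx'⟩)⟩
  choose! X hX1 hX2 using hX
  -- least second letter given the first
  have hY : ∀ v ∈ F, ∃ y : G, a (X v) + b y + c (s - X v - y) = v ∧
      ∀ y', a (X v) + b y' + c (s - X v - y') = v → enc y ≤ enc y' := by
    intro v hv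
    obtain ⟨y₀, h₀⟩ := hX1 v hv
    obtain ⟨y, hy, hmin⟩ := exists_min_image (univ.filter fun y : G => a (X v) + b y + c (s - X v - y) = v) enc
      ⟨y₀, mem_filter.2 ⟨mem_univ _, h₀⟩⟩
    exact ⟨y, (mem_filter.1 hy).2, fun y' hy' => hmin y' (mem_filter.2 ⟨mem_univ _, hy'⟩)⟩
  choose! Y hY1 hY2 using hY
  -- the spelling map
  refine card_le_card_of_injOn (fun v => (X v, Y v, s - X v - Y v)) (fun v hv => ?_) ?_
  swap
  · intro v hv v' hv' heq
    have hvF : v ∈ F := (mem_filter.1 (mem_coe.1 hv)).1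
    have hv'F : v' ∈ F := (mem_filter.1 (mem_coe.1 hv')).1
    simp only [Prod.mk.injEq] at heq
    rw [← hY1 v hvF, ← hY1 v' hv'F, heq.1, heq.2.1]
  obtain ⟨hvF, t₀, ht₀⟩ := mem_filter.1 hv
  set x := X v with hx
  set y := Y v with hy
  set z := s - X v - Y v with hz
  have hxyz : x + y + z = s := by rw [hz]; abel
  have hv : a x + b y + c z = v := hY1 v hvF
  refine mem_coe.2 (mem_filter.2 ⟨?_, hxyz⟩)
  -- the sample exposing `v`
  obtain ⟨htop, hmem⟩ := isStrictTop_texp ht₀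
  obtain ⟨i, hi, hτ⟩ := exists_tau_eq hmem
  rw [← hτ] at htop
  set w : Fin 2 → ℝ := ![σ, tau a b c σ i] with hw
  unfold triWords
  refine mem_filter.2 ⟨mem_univ _, i, hi, ?_, ?_, ?_⟩
  · -- `P`: `x` tops the fibre `x + y`
    show topLetter w (fun x' => a x' + b (x + y - x')) = x
    have exy : x + y - x = y := add_sub_cancel_left x y
    refine topLetter_eq_of_isStrictTop ?_ fun x' hx' => ?_
    · simp only [exy]
      refine isStrictTop_of_add_left (u := c z) (F := F) (by rw [add_comm, hv]; exact htop)
        (mem_image.2 ⟨x, mem_univ _, by simp only [exy]⟩) fun q hq => ?_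
      obtain ⟨x', -, rfl⟩ := mem_image.1 hq
      rw [add_comm]; exact hmemF (by rw [← hxyz]; abel)
    · simp only [exy] at hx'
      refine hX2 v hvF x' ⟨x + y - x', ?_⟩
      rw [show s - x' - (x + y - x') = z by rw [← hxyz]; abel, hx', hv]
  · -- `Q`: `y` tops the fibre `y + z`
    show topLetter w (fun y' => b y' + c (y + z - y')) = y
    have eyz : y + z - y = z := add_sub_cancel_left y z
    refine topLetter_eq_of_isStrictTop ?_ fun y' hy' => ?_
    · simp only [eyz]
      refine isStrictTop_of_add_left (u := a x) (F := F) (by rw [← add_assoc, hv]; exact htop)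
        (mem_image.2 ⟨y, mem_univ _, by simp only [eyz]⟩) fun q hq => ?_
      obtain ⟨y', -, rfl⟩ := mem_image.1 hq
      rw [← add_assoc]; exact hmemF (by rw [← hxyz]; abel)
    · simp only [eyz] at hy'
      refine hY2 v hvF y' ?_
      rw [show s - X v - y' = y + z - y' by rw [← hx, ← hxyz]; abel, ← hx, add_assoc, hy', ← add_assoc, hv]
  · -- `R`: `x` tops the fibre `x + z`
    show topLetter w (fun x' => a x' + c (x + z - x')) = x
    have exz : x + z - x = z := add_sub_cancel_left x z
    refine topLetter_eq_of_isStrictTop ?_ fun x' hx' => ?_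
    · simp only [exz]
      refine isStrictTop_of_add_left (u := b y) (F := F) (by rw [add_comm, add_right_comm, hv]; exact htop)
        (mem_image.2 ⟨x, mem_univ _, by simp only [exz]⟩) fun q hq => ?_
      obtain ⟨x', -, rfl⟩ := mem_image.1 hq
      rw [add_comm, add_right_comm]; exact hmemF (by rw [← hxyz]; abel)
    · simp only [exz] at hx'
      refine hX2 v hvF x' ⟨y, ?_⟩
      rw [show s - x' - y = x + z - x' by rw [← hxyz]; abel, add_right_comm, hx', ← add_right_comm, hv]

variable (a b c σ) in
open Classical in
/-- **`∑_s #tops_σ(class s) ≤ #triWords`** along the half-chart `σ`. [folklore] -/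
theorem sum_card_chartTops_le_card_triWords :
    ∑ s, ((univ.image fun p : G × G => a p.1 + b p.2 + c (s - p.1 - p.2)).filter fun v =>
        ∃ t, IsStrictTop ![σ, t] (univ.image fun p : G × G => a p.1 + b p.2 + c (s - p.1 - p.2)) v).card ≤
      (triWords (Nσ a b c σ) (TPs a b c σ) (TQs a b c σ) (TRs a b c σ)).card := by
  classical
  rw [card_eq_sum_card_fiberwise (f := fun w : G × G × G => w.1 + w.2.1 + w.2.2) (t := univ) fun w _ => mem_univ _]
  exact sum_le_sum fun s _ => card_chartTops_le_card_triWords_fiber a b c σ s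

end Geometry

end TotalsLaw

end Summit.ValiantsHypothesis.ValiantsHypothesis.Theorems.NewtonUnitEquationsDissociatedUniform
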